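import Mathlib.Geometry.Manifold.BumpFunction
import Literature.Geometry.Lorentzian.MassCapacityPotential
import Literature.Geometry.Lorentzian.ExteriorRegionSchwarzschildEnd
import Literature.Geometry.Lorentzian.VolumePositivity
import HarnessLib

-- literature-prover provefact seat `Bray2001_mass_ge_half_capacity`, session 9 (2026-08-15)
/-!
# A minimiser of the capacity functional is the harmonic potential (Bray 2001, §6: "the infimum
# … is achieved by the Green's function", the Euler–Lagrange direction)

Theorems only; a sibling of `MassCapacity.lean` (Bray, J. Differential Geom. 59 (2001), §6,
Def. 17: `ℰ(Σ, g) = inf_φ (1/2π) ∫ |∇φ|² dV` over the test functions `IsCapacityTestFn e U`,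
vendored as `horizonCapacity h e U`) and of `MassCapacityHarmonic.lean` /
`MassCapacityPotential.lean`. Bray asserts (after Def. 17, (86)): *"The infimum in the above
definition is achieved by the Green's function `φ(x)` which satisfies `lim_{x → ∞₀} φ = 1`,
`Δφ = 0`, `φ = 0` on `Σ`"*. The tree proves the direction "the harmonic potential attains the
infimum" (`horizonCapacity_eq_of_harmonic'`, the Dirichlet principle) and the uniqueness of the
potential (`IsCapacityTestFn.eq_of_harmonic`). This file proves the converse, Euler–Lagrange,
direction, which identifies *any* minimiser with that potential:

* `tendstoAtEnd_zero_of_hasCompactSupport`, `IsCapacityTestFn.add_const_mul` — compactly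
  supported smooth variations `φ₀ + tψ` (`tsupport ψ ⊆ U`) stay in the class of Def. 17;
* `IsCapacityTestFn.integral_innerDual_mvfderiv_eq_zero_of_isMinimal` — **the first variation
  vanishes at a minimiser**: if `φ₀` has least (finite) energy in the class, then
  `∫ h⁻¹(dψ, dφ₀) dV = 0` for every `ψ ∈ C^∞_c` with `tsupport ψ ⊆ U` (the energy of `φ₀ + tψ`
  over the compact `tsupport ψ` is the real quadratic `a + 2bt + ct²`, minimal at `t = 0`);
* `IsCapacityTestFn.dalembertian_eq_zero_of_isMinimal` — **a minimiser is `h`-harmonic on `U`**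
  (Green's first identity `∫ ψ Δf = −∫ h⁻¹(dψ, df)`, `GreenIdentityCompactSupport.lean`, for a
  globalisation `f` of `φ₀` near a point, and a smooth bump `ψ ≥ 0` concentrated where `Δφ₀`
  has a sign: the Riemannian measure charges open sets, `riemannianVolume_pos_of_isOpen`);
* `IsCapacityTestFn.dalembertian_eq_zero_of_horizonCapacity_eq` — the same for a test function
  realising the infimum `ℰ(Σ, g)` with finite energy;
* `IsCapacityTestFn.eq_of_horizonCapacity_eq` — **uniqueness of the minimiser** on the outside
  of a horizon (two minimisers are harmonic, hence equal by `IsCapacityTestFn.eq_of_harmonic`),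
  and `IsCapacityTestFn.eq_of_horizonCapacity_eq_of_harmonic` — a minimiser *is* the harmonic
  potential of (86) whenever the latter exists.

No definitions and no named facts are introduced; existence of a minimiser is not claimed.

## References

* H. L. Bray, *Proof of the Riemannian Penrose inequality using the positive mass theorem*,
  J. Differential Geom. 59 (2001) 177–267 (arXiv:math/9911173): §6, Def. 17 and (86) ("the
  infimum … is achieved by the Green's function"). [BrayRPI2001]
* J. M. Lee, *Introduction to Riemannian Manifolds*, 2nd ed., GTM 176 (2018), Problem 2-23
  (harmonic functions are the critical points of the Dirichlet energy). [Lee2018]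
-/

noncomputable section

open Bundle Set Manifold TopologicalSpace Filter MeasureTheory Measure Topology Function
open scoped ContDiff Topology Manifold Real

namespace Literature.Geometry.Lorentzian

open PseudoRiemannianMetric

variable {X : Type} [TopologicalSpace X] [ChartedSpace E3 X]

/-! ### Compactly supported variations stay in the class of Def. 17 -/

section Variations

/-- **A compactly supported function tends to `0` at infinity in every end** (a compact set
misses all sufficiently far regions, `AFEnd.exists_radius_far_disjoint`). [folklore] -/
theorem tendstoAtEnd_zero_of_hasCompactSupport (e : AFEnd X) {ψ : X → ℝ}
    (hψ : HasCompactSupport ψ) : TendstoAtEnd e ψ 0 := by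
  obtain ⟨R₁, -, hfar⟩ := e.exists_radius_far_disjoint hψ.isCompact
  refine (e.tendstoAtEnd_iff_far).2 fun ε hε ↦ ⟨R₁, fun x hx ↦ ?_⟩
  have hx' : x ∉ tsupport ψ := fun h' ↦ Set.disjoint_left.1 (hfar R₁ le_rfl) hx h'
  rw [image_eq_zero_of_notMem_tsupport hx', dist_self]
  exact hε

/-- Reading in the chart of the end is linear: `endValue (φ₀ + tψ) = endValue φ₀ + t endValue ψ`.
[folklore] -/
theorem endValue_add_const_mul (e : AFEnd X) (φ₀ ψ : X → ℝ) (t : ℝ) :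
    endValue e (fun x ↦ φ₀ x + t * ψ x) = fun z ↦ endValue e φ₀ z + t * endValue e ψ z := by
  funext z
  by_cases hz : e.R < ‖z‖
  · simp only [endValue_of_lt e _ hz]
  · simp only [endValue_of_not_lt e _ hz, mul_zero, add_zero]

variable [IsManifold (𝓡 3) ∞ X] {e : AFEnd X} {U : Opens X}

omit [IsManifold (𝓡 3) ∞ X] in
/-- **Compactly supported smooth variations inside `U` preserve the class of Def. 17**: if `φ₀`
is a test function and `ψ ∈ C^∞(X)` has compact support with `tsupport ψ ⊆ U`, then
`φ₀ + tψ` is a test function (continuous, smooth on `U`, zero off `U`, `→ 1 + t·0` at infinity).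
[cite: BrayRPI2001, §6 Def. 17] -/
theorem IsCapacityTestFn.add_const_mul {φ₀ ψ : X → ℝ} (hφ₀ : IsCapacityTestFn e U φ₀)
    (hψ : ContMDiff (𝓡 3) 𝓘(ℝ, ℝ) ∞ ψ) (hψc : HasCompactSupport ψ)
    (hsupp : tsupport ψ ⊆ (U : Set X)) (t : ℝ) :
    IsCapacityTestFn e U (fun x ↦ φ₀ x + t * ψ x) := by
  refine ⟨hφ₀.continuous.add (continuous_const.mul hψ.continuous),
    hφ₀.contMDiffOn.add (contMDiffOn_const.mul hψ.contMDiffOn), fun x hx ↦ ?_, ?_⟩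
  · show φ₀ x + t * ψ x = 0
    rw [hφ₀.2.2.1 x hx, image_eq_zero_of_notMem_tsupport fun h' ↦ hx (hsupp h'), mul_zero,
      add_zero]
  · have h1 := hφ₀.tendstoAtEnd
    have h0 := tendstoAtEnd_zero_of_hasCompactSupport e hψc
    unfold TendstoAtEnd at h1 h0 ⊢
    rw [endValue_add_const_mul]
    simpa using h1.add (h0.const_mul t)

end Variations

/-! ### The energy of `φ₀ + tψ` over `tsupport ψ` -/

section Algebra

variable [IsManifold (𝓡 3) ∞ X]
  (h : ContMDiffRiemannianMetric (𝓡 3) ∞ E3 (TangentSpace (𝓡 3) : X → Type _))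

omit [IsManifold (𝓡 3) ∞ X] in
/-- `d(φ₀ + tψ) = dφ₀ + t dψ` where both are differentiable. [folklore] -/
theorem mvfderiv_add_const_mul {φ₀ ψ : X → ℝ} {x : X}
    (hφ₀ : MDifferentiableAt (𝓡 3) 𝓘(ℝ, ℝ) φ₀ x) (hψ : MDifferentiableAt (𝓡 3) 𝓘(ℝ, ℝ) ψ x)
    (t : ℝ) :
    mvfderiv (𝓡 3) (fun y ↦ φ₀ y + t * ψ y) x = mvfderiv (𝓡 3) φ₀ x + t • mvfderiv (𝓡 3) ψ x := by
  have hψt : MDifferentiableAt (𝓡 3) 𝓘(ℝ, ℝ) (t • ψ) x := hψ.const_smul t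
  have h1 : (fun y ↦ φ₀ y + t * ψ y) = φ₀ + t • ψ := by
    funext y
    simp [smul_eq_mul]
  rw [h1, mvfderiv_add hφ₀ hψt]
  congr 1
  ext v
  simp [mvfderiv, const_smul_mfderiv hψ t]
  rfl

/-- **The energy density of `φ₀ + tψ`**: `|∇(φ₀ + tψ)|² = |∇φ₀|² + 2t h⁻¹(dψ, dφ₀) + t² |∇ψ|²`
where both are differentiable. [folklore] -/
theorem gradNorm_sq_add_const_mul {φ₀ ψ : X → ℝ} {x : X}
    (hφ₀ : MDifferentiableAt (𝓡 3) 𝓘(ℝ, ℝ) φ₀ x) (hψ : MDifferentiableAt (𝓡 3) 𝓘(ℝ, ℝ) ψ x)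
    (t : ℝ) :
    gradNorm h (fun y ↦ φ₀ y + t * ψ y) x ^ 2 = gradNorm h φ₀ x ^ 2 +
      2 * t * (ofRiemannian h).innerDual x (mvfderiv (𝓡 3) ψ x).toLinearMap
        (mvfderiv (𝓡 3) φ₀ x).toLinearMap + t ^ 2 * gradNorm h ψ x ^ 2 := by
  simp only [gradNorm_sq_eq_innerDual_mvfderiv]
  rw [mvfderiv_add_const_mul hφ₀ hψ t, ContinuousLinearMap.toLinearMap_add,
    ContinuousLinearMap.toLinearMap_smul]
  set A := (mvfderiv (𝓡 3) φ₀ x).toLinearMap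
  set B := (mvfderiv (𝓡 3) ψ x).toLinearMap
  have hc : (ofRiemannian h).innerDual x A B = (ofRiemannian h).innerDual x B A :=
    (ofRiemannian h).innerDual_comm x A B
  simp only [PseudoRiemannianMetric.innerDual, LinearMap.add_apply, LinearMap.smul_apply, map_add,
    map_smul, smul_eq_mul] at hc ⊢
  linear_combination (t : ℝ) * hc

/-- From `a ≤ a + 2tb + t²c` for all real `t` (with `c ≥ 0`): `b = 0`. [folklore] -/
theorem eq_zero_of_forall_le_add_quadratic {a b c : ℝ} (hc : 0 ≤ c)
    (hq : ∀ t : ℝ, a ≤ a + 2 * t * b + t ^ 2 * c) : b = 0 := by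
  by_contra hb
  have hc1 : 0 < c + 1 := by linarith
  have key := hq (-b / (c + 1))
  have hid : 2 * (-b / (c + 1)) * b + (-b / (c + 1)) ^ 2 * c = -(b ^ 2 * (c + 2)) / (c + 1) ^ 2 := by
    field_simp
    ring
  have hb2 : 0 < b ^ 2 := by positivity
  have hneg : -(b ^ 2 * (c + 2)) / (c + 1) ^ 2 < 0 :=
    div_neg_of_neg_of_pos (by nlinarith) (by positivity)
  linarith

end Algebra

/-! ### The first variation of the energy vanishes at a minimiser -/

section FirstVariation

variable [IsManifold (𝓡 3) ∞ X] [T2Space X] [LocallyCompactSpace X] [SigmaCompactSpace X]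
  [MeasurableSpace X] [BorelSpace X]
  (h : ContMDiffRiemannianMetric (𝓡 3) ∞ E3 (TangentSpace (𝓡 3) : X → Type _))
  {e : AFEnd X} {U : Opens X}

omit [MeasurableSpace X] [BorelSpace X] in
/-- `|∇φ|²` is continuous on an open set on which `φ` is `C¹`. [folklore] -/
theorem continuousOn_gradNorm_sq {V : Set X} (hV : IsOpen V) {φ : X → ℝ}
    (hφ : ContMDiffOn (𝓡 3) 𝓘(ℝ, ℝ) 1 φ V) : ContinuousOn (fun x ↦ gradNorm h φ x ^ 2) V := by
  have heq : (fun x ↦ gradNorm h φ x ^ 2) = fun x ↦ (ofRiemannian h).innerDual x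
      (mvfderiv (𝓡 3) φ x).toLinearMap (mvfderiv (𝓡 3) φ x).toLinearMap :=
    funext fun x ↦ gradNorm_sq_eq_innerDual_mvfderiv h φ x
  rw [heq]
  exact continuousOn_innerDual_mvfderiv h hV hφ hφ

/-- **The first variation of the Dirichlet energy vanishes at a minimiser of Def. 17.** Let `φ₀`
be a test function of the capacity of `Σ = ∂U` with finite energy which minimises the energy in
the class `IsCapacityTestFn e U`, and let `ψ ∈ C^∞(X)` have compact support `tsupport ψ ⊆ U`.
Then `∫_X h⁻¹(dψ, dφ₀) dV_h = 0`. (The variations `φ₀ + tψ` are test functions; off the compact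
`K = tsupport ψ` their energy densities agree with that of `φ₀`, and over `K` the energy is the
real quadratic `∫_K |∇φ₀|² + 2t ∫_K h⁻¹(dψ, dφ₀) + t² ∫_K |∇ψ|²`, which is `≥ ∫_K |∇φ₀|²` for all
`t` only if the linear coefficient vanishes.) This is the Euler–Lagrange half of Bray's "the
infimum … is achieved by the Green's function" (§6, after Def. 17).
[cite: BrayRPI2001, §6 Def. 17 and (86)] [cite: Lee2018, Problem 2-23] -/
theorem IsCapacityTestFn.integral_innerDual_mvfderiv_eq_zero_of_isMinimal {φ₀ ψ : X → ℝ}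
    (hφ₀ : IsCapacityTestFn e U φ₀) (hfin : dirichletEnergy h φ₀ ≠ ⊤)
    (hmin : ∀ φ : X → ℝ, IsCapacityTestFn e U φ → dirichletEnergy h φ₀ ≤ dirichletEnergy h φ)
    (hψ : ContMDiff (𝓡 3) 𝓘(ℝ, ℝ) ∞ ψ) (hψc : HasCompactSupport ψ)
    (hsupp : tsupport ψ ⊆ (U : Set X)) :
    ∫ x, (ofRiemannian h).innerDual x (mvfderiv (𝓡 3) ψ x).toLinearMap
      (mvfderiv (𝓡 3) φ₀ x).toLinearMap ∂riemannianMeasure h = 0 := by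
  haveI : IsFiniteMeasureOnCompacts (riemannianMeasure h) :=
    ⟨fun K hK ↦ riemannianVolume_lt_top_of_isCompact_holds h le_rfl hK⟩
  set μ : Measure X := riemannianMeasure h with hμ
  set K : Set X := tsupport ψ with hK
  have hKc : IsCompact K := hψc
  have hKm : MeasurableSet K := (isClosed_tsupport ψ).measurableSet
  have h1 : (1 : ℕ∞ω) ≤ ∞ := by exact_mod_cast le_top
  -- the variations and their differentiability on `U`
  set Φ : ℝ → X → ℝ := fun t y ↦ φ₀ y + t * ψ y with hΦ
  have hΦmem : ∀ t, IsCapacityTestFn e U (Φ t) := fun t ↦ hφ₀.add_const_mul hψ hψc hsupp t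
  have hdφ₀ : ∀ x ∈ (U : Set X), MDifferentiableAt (𝓡 3) 𝓘(ℝ, ℝ) φ₀ x := fun x hx ↦
    ((hφ₀.contMDiffOn.of_le h1).contMDiffAt (U.isOpen.mem_nhds hx)).mdifferentiableAt one_ne_zero
  have hdψ : ∀ x, MDifferentiableAt (𝓡 3) 𝓘(ℝ, ℝ) ψ x := fun x ↦
    (hψ.of_le h1).mdifferentiableAt one_ne_zero
  -- the integrands
  set g : ℝ → X → ℝ := fun t x ↦ gradNorm h (Φ t) x ^ 2 with hg
  set P : X → ℝ := fun x ↦ (ofRiemannian h).innerDual x (mvfderiv (𝓡 3) ψ x).toLinearMap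
    (mvfderiv (𝓡 3) φ₀ x).toLinearMap with hP
  set q : X → ℝ := fun x ↦ gradNorm h ψ x ^ 2 with hq
  have hg0 : g 0 = fun x ↦ gradNorm h φ₀ x ^ 2 := by
    funext x
    simp [hg, hΦ]
  -- pointwise expansion on `U`
  have hexp : ∀ t, ∀ x ∈ (U : Set X), g t x = g 0 x + 2 * t * P x + t ^ 2 * q x := by
    intro t x hx
    rw [hg0]
    exact gradNorm_sq_add_const_mul h (hdφ₀ x hx) (hdψ x) t
  -- continuity on `U`, integrability on `K`
  have hgc : ∀ t, ContinuousOn (g t) (U : Set X) := fun t ↦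
    continuousOn_gradNorm_sq h U.isOpen ((hΦmem t).contMDiffOn.of_le h1)
  have hPc : ContinuousOn P (U : Set X) :=
    continuousOn_innerDual_mvfderiv h U.isOpen (hψ.contMDiffOn.of_le h1)
      (hφ₀.contMDiffOn.of_le h1)
  have hqc : ContinuousOn q (U : Set X) := continuousOn_gradNorm_sq h U.isOpen (hψ.contMDiffOn.of_le h1)
  have hgi : ∀ t, IntegrableOn (g t) K μ := fun t ↦ ((hgc t).mono hsupp).integrableOn_compact hKc
  have hPi : IntegrableOn P K μ := (hPc.mono hsupp).integrableOn_compact hKc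
  have hqi : IntegrableOn q K μ := (hqc.mono hsupp).integrableOn_compact hKc
  have hg_nonneg : ∀ t x, 0 ≤ g t x := fun t x ↦ by positivity
  -- off `K` the energy densities agree
  have hoff : ∀ t, ∀ x ∈ Kᶜ, g t x = g 0 x := by
    intro t x hx
    have hev : Φ t =ᶠ[𝓝 x] Φ 0 := by
      have h0 : ψ =ᶠ[𝓝 x] fun _ ↦ 0 := notMem_tsupport_iff_eventuallyEq.1 hx
      filter_upwards [h0] with y hy
      simp [hΦ, hy]
    simp only [hg]
    rw [gradNorm_congr_of_eventuallyEq h hev]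
  -- the energies split along `K`
  set I : ℝ → ℝ := fun t ↦ ∫ x in K, g t x ∂μ with hI
  have hI_nonneg : ∀ t, 0 ≤ I t := fun t ↦ setIntegral_nonneg hKm fun x _ ↦ hg_nonneg t x
  have hA : ∀ t, ∫⁻ x in K, ENNReal.ofReal (g t x) ∂μ = ENNReal.ofReal (I t) := fun t ↦
    (ofReal_integral_eq_lintegral_ofReal (hgi t) (ae_of_all _ (hg_nonneg t))).symm
  have hsplit : ∀ t, dirichletEnergy h (Φ t) =
      ENNReal.ofReal (I t) + ∫⁻ x in Kᶜ, ENNReal.ofReal (g 0 x) ∂μ := by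
    intro t
    rw [dirichletEnergy, ← lintegral_add_compl _ hKm, hA t]
    congr 1
    exact setLIntegral_congr_fun hKm.compl fun x hx ↦ by
      show ENNReal.ofReal (g t x) = ENNReal.ofReal (g 0 x)
      rw [hoff t x hx]
  have hΦ0 : Φ 0 = φ₀ := by
    funext y
    simp [hΦ]
  have hB : ∫⁻ x in Kᶜ, ENNReal.ofReal (g 0 x) ∂μ ≠ ⊤ := by
    refine ne_top_of_le_ne_top hfin ?_
    rw [← hΦ0, hsplit 0]
    exact le_add_self
  -- minimality over `K`, in `ℝ`
  have hImin : ∀ t, I 0 ≤ I t := by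
    intro t
    have hle := hmin (Φ t) (hΦmem t)
    rw [← hΦ0, hsplit 0, hsplit t] at hle
    -- `← hΦ0` also rewrote the `φ₀` hidden in `Φ t`; undo nothing: both sides are as displayed
    exact (ENNReal.ofReal_le_ofReal_iff (hI_nonneg t)).1 ((ENNReal.add_le_add_iff_right hB).1 hle)
  -- the quadratic expansion of `I`
  have hIexp : ∀ t, I t = I 0 + 2 * t * (∫ x in K, P x ∂μ) + t ^ 2 * (∫ x in K, q x ∂μ) := by
    intro t
    have h1' : I t = ∫ x in K, (g 0 x + 2 * t * P x + t ^ 2 * q x) ∂μ :=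
      setIntegral_congr_fun hKm fun x hx ↦ hexp t x (hsupp hx)
    have hi3 : Integrable (fun x ↦ 2 * t * P x) (μ.restrict K) := hPi.const_mul (2 * t)
    have hi1 : Integrable (fun x ↦ g 0 x + 2 * t * P x) (μ.restrict K) := (hgi 0).add hi3
    have hi2 : Integrable (fun x ↦ t ^ 2 * q x) (μ.restrict K) := hqi.const_mul (t ^ 2)
    rw [h1', integral_add hi1 hi2, integral_add (hgi 0) hi3, integral_const_mul, integral_const_mul]
  -- hence the linear coefficient vanishes
  have hb : ∫ x in K, P x ∂μ = 0 :=
    eq_zero_of_forall_le_add_quadratic (setIntegral_nonneg hKm fun x _ ↦ by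
        show 0 ≤ gradNorm h ψ x ^ 2
        positivity)
      fun t ↦ by rw [← hIexp t]; exact hImin t
  -- and the pairing vanishes off `K`
  rw [← hb]
  refine (setIntegral_eq_integral_of_forall_compl_eq_zero fun x hx ↦ ?_).symm
  simp only [mvfderiv_eq_zero_of_notMem_tsupport hx, ContinuousLinearMap.toLinearMap_zero,
    PseudoRiemannianMetric.innerDual, LinearMap.zero_apply]

end FirstVariation

/-! ### A minimiser is harmonic on `U` -/

section EulerLagrange

variable [IsManifold (𝓡 3) ∞ X] [T2Space X] [LocallyCompactSpace X] [SigmaCompactSpace X]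
  [MeasurableSpace X] [BorelSpace X]
  (h : ContMDiffRiemannianMetric (𝓡 3) ∞ E3 (TangentSpace (𝓡 3) : X → Type _))
  [(ofRiemannian h).HasLeviCivita] {e : AFEnd X} {U : Opens X}

omit [(ofRiemannian h).HasLeviCivita] in
/-- **Localised sign test.** If `G` is continuous with `G(x₀) > 0`, `x₀ ∈ V`
open, then there is a smooth compactly supported `ψ ≥ 0` with `tsupport ψ ⊆ V` and
`∫ ψ G dV_h > 0` (a smooth bump at `x₀` supported where `G > 0`; the Riemannian measure charges
the open set where `ψ = 1`). [folklore] -/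
theorem exists_bump_integral_mul_pos {G : X → ℝ} (hG : Continuous G) {x₀ : X} (hx₀ : 0 < G x₀)
    {V : Set X} (hV : IsOpen V) (hxV : x₀ ∈ V) :
    ∃ ψ : X → ℝ, ContMDiff (𝓡 3) 𝓘(ℝ, ℝ) ∞ ψ ∧ HasCompactSupport ψ ∧ tsupport ψ ⊆ V ∧
      (∀ x, 0 ≤ ψ x) ∧ 0 < ∫ x, ψ x * G x ∂riemannianMeasure h := by
  haveI : IsFiniteMeasureOnCompacts (riemannianMeasure h) :=
    ⟨fun K hK ↦ riemannianVolume_lt_top_of_isCompact_holds h le_rfl hK⟩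
  -- the open set `S = V ∩ {G > 0}` is a neighbourhood of `x₀`
  set S : Set X := V ∩ {x | 0 < G x} with hS
  have hSo : IsOpen S := hV.inter (isOpen_lt continuous_const hG)
  have hxS : x₀ ∈ S := ⟨hxV, hx₀⟩
  obtain ⟨f, -, hf⟩ := (SmoothBumpFunction.nhds_basis_tsupport (I := 𝓡 3) x₀).mem_iff.1
    (hSo.mem_nhds hxS)
  refine ⟨f, f.contMDiff, f.hasCompactSupport, hf.trans inter_subset_left, fun x ↦ f.nonneg, ?_⟩
  -- the integrand is continuous, compactly supported and nonnegative
  have hnn : ∀ x, 0 ≤ f x * G x := by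
    intro x
    by_cases hx : x ∈ support (f : X → ℝ)
    · exact mul_nonneg f.nonneg (hf (subset_closure hx)).2.le
    · rw [notMem_support.1 hx, zero_mul]
  have hint : Integrable (fun x ↦ f x * G x) (riemannianMeasure h) :=
    (f.continuous.mul hG).integrable_of_hasCompactSupport (f.hasCompactSupport.mul_right)
  rw [integral_pos_iff_support_of_nonneg hnn hint]
  -- the support contains the open neighbourhood `{f = 1} ∩ {G > 0}` of `x₀`
  have hW : ∀ᶠ x in 𝓝 x₀, x ∈ support fun x ↦ f x * G x := by
    filter_upwards [f.eventuallyEq_one, (isOpen_lt continuous_const hG).mem_nhds hx₀] with x hx1 hxG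
    rw [mem_support, hx1, Pi.one_apply, one_mul]
    exact (ne_of_gt hxG)
  obtain ⟨W, hWsub, hWo, hxW⟩ := mem_nhds_iff.1 hW
  calc (0 : ENNReal) < riemannianMeasure h W := riemannianVolume_pos_of_isOpen h hWo ⟨x₀, hxW⟩
    _ ≤ riemannianMeasure h (support fun x ↦ f x * G x) := measure_mono hWsub

/-- **A minimiser of the capacity functional is `h`-harmonic on the outside `U`** (the
Euler–Lagrange equation of Def. 17). Let `φ₀ ∈ IsCapacityTestFn e U` have finite energy, least
among all test functions. Then `Δ_h φ₀ = 0` on `U`. Proof: at `x₀ ∈ U`, globalise `φ₀` to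
`f ∈ C²(X)` agreeing with `φ₀` near `x₀` (`exists_contMDiff_hasCompactSupport_eventuallyEq`); if
`Δ_h φ₀(x₀) = Δ_h f(x₀) ≠ 0`, a smooth bump `ψ ≥ 0` supported where `±Δ_h f > 0` has
`±∫ ψ Δ_h f dV > 0`, while Green's first identity and the vanishing of the first variation give
`∫ ψ Δ_h f dV = −∫ h⁻¹(dψ, df) dV = −∫ h⁻¹(dψ, dφ₀) dV = 0`. With the Dirichlet principle
(`horizonCapacity_eq_of_harmonic'`) this is Bray's "the infimum … is achieved by the Green's
function (86)". [cite: BrayRPI2001, §6 Def. 17 and (86)] [cite: Lee2018, Problem 2-23] -/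
theorem IsCapacityTestFn.dalembertian_eq_zero_of_isMinimal {φ₀ : X → ℝ}
    (hφ₀ : IsCapacityTestFn e U φ₀) (hfin : dirichletEnergy h φ₀ ≠ ⊤)
    (hmin : ∀ φ : X → ℝ, IsCapacityTestFn e U φ → dirichletEnergy h φ₀ ≤ dirichletEnergy h φ) :
    ∀ x ∈ (U : Set X), (ofRiemannian h).dalembertian φ₀ x = 0 := by
  intro x₀ hx₀
  have h2 : (2 : ℕ∞ω) ≤ ∞ := WithTop.coe_le_coe.mpr le_top
  -- globalise `φ₀` near `x₀`
  obtain ⟨f, hf, -, -, V, hVo, hxV, hVU, hfφ⟩ :=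
    exists_contMDiff_hasCompactSupport_eventuallyEq (n := 2) U.isOpen isCompact_singleton
      (singleton_subset_iff.2 hx₀) (hφ₀.contMDiffOn.of_le h2)
  have hxV' : x₀ ∈ V := singleton_subset_iff.1 hxV
  have hLc : Continuous ((ofRiemannian h).dalembertian f) := continuous_dalembertian (ofRiemannian h) hf
  have hLx : (ofRiemannian h).dalembertian f x₀ = (ofRiemannian h).dalembertian φ₀ x₀ :=
    (ofRiemannian h).dalembertian_congr_of_eventuallyEq (hfφ x₀ hxV')
  -- Green + first variation: `∫ ψ Δf = 0` for bumps supported in `V`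
  have hGreen : ∀ ψ : X → ℝ, ContMDiff (𝓡 3) 𝓘(ℝ, ℝ) ∞ ψ → HasCompactSupport ψ →
      tsupport ψ ⊆ V → ∫ x, ψ x * (ofRiemannian h).dalembertian f x ∂riemannianMeasure h = 0 := by
    intro ψ hψ hψc hψV
    have h1 : (1 : ℕ∞ω) ≤ ∞ := by exact_mod_cast le_top
    rw [integral_mul_dalembertian_eq_neg_integral_innerDual_of_hasCompactSupport h (hψ.of_le h1)
      hψc hf]
    have hR : (fun p ↦ (ofRiemannian h).innerDual p (mvfderiv (𝓡 3) ψ p).toLinearMap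
        (mvfderiv (𝓡 3) f p).toLinearMap) = fun p ↦ (ofRiemannian h).innerDual p
          (mvfderiv (𝓡 3) ψ p).toLinearMap (mvfderiv (𝓡 3) φ₀ p).toLinearMap := by
      funext p
      by_cases hp : p ∈ tsupport ψ
      · rw [mvfderiv_congr_of_eventuallyEq (hfφ p (hψV hp))]
      · simp only [mvfderiv_eq_zero_of_notMem_tsupport hp, ContinuousLinearMap.toLinearMap_zero,
          PseudoRiemannianMetric.innerDual, LinearMap.zero_apply]
    rw [hR, hφ₀.integral_innerDual_mvfderiv_eq_zero_of_isMinimal h hfin hmin hψ hψc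
      (hψV.trans hVU), neg_zero]
  -- sign test
  by_contra hne
  rw [← hLx] at hne
  rcases lt_or_gt_of_ne (a := (ofRiemannian h).dalembertian f x₀) (b := 0) hne with hlt | hgt
  · -- `Δf(x₀) < 0`: test against `-Δf`
    have hGc : Continuous fun x ↦ -(ofRiemannian h).dalembertian f x := hLc.neg
    have hGx : 0 < -(ofRiemannian h).dalembertian f x₀ := by linarith
    obtain ⟨ψ, hψ, hψc, hψV, -, hpos⟩ := exists_bump_integral_mul_pos h hGc hGx hVo hxV'
    have h0 := hGreen ψ hψ hψc hψV
    have : ∫ x, ψ x * -(ofRiemannian h).dalembertian f x ∂riemannianMeasure h = 0 := by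
      simp only [mul_neg, integral_neg, h0, neg_zero]
    linarith
  · obtain ⟨ψ, hψ, hψc, hψV, -, hpos⟩ := exists_bump_integral_mul_pos h hLc hgt hVo hxV'
    linarith [hGreen ψ hψ hψc hψV]

/-- **A test function realising `ℰ(Σ, g)` with finite energy is `h`-harmonic on `U`.** If
`(1/2π) ∫ |∇φ₀|² dV = ℰ(Σ, g)` (`horizonCapacity h e U`) for a test function `φ₀` of finite
energy, then `Δ_h φ₀ = 0` on `U`. Bray 2001, §6: "the infimum … is achieved by the Green's
function" (86). [cite: BrayRPI2001, §6 Def. 17 and (86)] -/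
theorem IsCapacityTestFn.dalembertian_eq_zero_of_horizonCapacity_eq {φ₀ : X → ℝ}
    (hφ₀ : IsCapacityTestFn e U φ₀) (hfin : dirichletEnergy h φ₀ ≠ ⊤)
    (heq : ENNReal.ofReal (2 * π)⁻¹ * dirichletEnergy h φ₀ = horizonCapacity h e U) :
    ∀ x ∈ (U : Set X), (ofRiemannian h).dalembertian φ₀ x = 0 := by
  refine hφ₀.dalembertian_eq_zero_of_isMinimal h hfin fun φ hφ ↦ ?_
  have hc0 : ENNReal.ofReal (2 * π)⁻¹ ≠ 0 := (ENNReal.ofReal_pos.2 (by positivity)).ne'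
  have hle : ENNReal.ofReal (2 * π)⁻¹ * dirichletEnergy h φ₀ ≤
      ENNReal.ofReal (2 * π)⁻¹ * dirichletEnergy h φ := by
    rw [heq]
    exact horizonCapacity_le h e U hφ
  exact (ENNReal.mul_le_mul_iff_right hc0 ENNReal.ofReal_ne_top).1 hle

/-- **Uniqueness of the minimiser on the outside of a horizon.** On an exterior region `U`, two
test functions of finite energy both realising `ℰ(Σ, g)` coincide: both are `h`-harmonic on `U`
(`dalembertian_eq_zero_of_horizonCapacity_eq`), hence equal by the uniqueness of the capacity
potential (`IsCapacityTestFn.eq_of_harmonic`, the minimum principle). Bray 2001, §6 ("*the*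
Green's function (86)"). [cite: BrayRPI2001, §6 Def. 17 and (86)] -/
theorem IsCapacityTestFn.eq_of_horizonCapacity_eq (hU : IsExteriorRegion e U) {φ₀ φ₁ : X → ℝ}
    (hφ₀ : IsCapacityTestFn e U φ₀) (hφ₁ : IsCapacityTestFn e U φ₁)
    (hfin₀ : dirichletEnergy h φ₀ ≠ ⊤) (hfin₁ : dirichletEnergy h φ₁ ≠ ⊤)
    (heq₀ : ENNReal.ofReal (2 * π)⁻¹ * dirichletEnergy h φ₀ = horizonCapacity h e U)
    (heq₁ : ENNReal.ofReal (2 * π)⁻¹ * dirichletEnergy h φ₁ = horizonCapacity h e U) :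
    φ₀ = φ₁ :=
  hφ₀.eq_of_harmonic h hU hφ₁ (hφ₀.dalembertian_eq_zero_of_horizonCapacity_eq h hfin₀ heq₀)
    (hφ₁.dalembertian_eq_zero_of_horizonCapacity_eq h hfin₁ heq₁)

/-- **A minimiser is the harmonic potential (86).** On an exterior region `U`, a test function
of finite energy realising `ℰ(Σ, g)` coincides with any `h`-harmonic test function `φ` (the
capacity potential of Bray's (86), when it exists). [cite: BrayRPI2001, §6 Def. 17 and (86)] -/
theorem IsCapacityTestFn.eq_of_horizonCapacity_eq_of_harmonic (hU : IsExteriorRegion e U)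
    {φ₀ φ : X → ℝ} (hφ₀ : IsCapacityTestFn e U φ₀) (hfin₀ : dirichletEnergy h φ₀ ≠ ⊤)
    (heq₀ : ENNReal.ofReal (2 * π)⁻¹ * dirichletEnergy h φ₀ = horizonCapacity h e U)
    (hφ : IsCapacityTestFn e U φ) (hΔ : ∀ x ∈ (U : Set X), (ofRiemannian h).dalembertian φ x = 0) :
    φ₀ = φ :=
  hφ₀.eq_of_harmonic h hU hφ (hφ₀.dalembertian_eq_zero_of_horizonCapacity_eq h hfin₀ heq₀) hΔ

end EulerLagrange

end Literature.Geometry.Lorentzian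

end
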